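import Summits.QuantumFields.YangMills.Theorems.BalabanUVNodesN19OffWindowPrice
import Summits.QuantumFields.YangMills.Theorems.BalabanUVNodesN19ExpectationCurrencyAtScheme

/-!
# YM-DAG node N19 (= NE7 proper) — THE OFF-WINDOW PRICE AT THE SCHEME: the source window of `MatchingModConstants` ∕ `Spine.NE7.Target`
# ENLARGES — from `|t| ≤ l₀` to every `|t| ≤ l₁` at the cost `2volδ_K ↦ (2·max(1,l₁)·e^{l₀+l₁})·(2volδ_K)^{1 − 2·arcosh(l₁∕l₀)∕arcosh(1 + log⁺(2volδ_K)⁻¹∕l₀)}`;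
# a geometric remainder stays summable on every window

Cell `pub-ymgap`, HUMAN RULING D-0062 (Track A), R141 (C) wider-strategy seat `pub-ymgap-dag-n19-e` (strategy s3 = ALTERNATIVE CURRENCY), generation
g14, module 2 (sibling of `…Theorems.BalabanUVNodesN19OffWindowPrice`, filed right before).  Route `Summits/QuantumFields/YangMills/Theses/BalabanUVNodes.lean`
rev 21, cluster item K3⁵ «SpineGivenEndpointR13SepCoP» (stmt-QuantumFields-20296; KEY-20 ∕ dag-lead WORDS-141 — module 1 p521610 was filed on the ⁗ item
20292 before the re-key); filed `--supports` that item `--as helper` (it proves no registered stub).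
COUNT-NEUTRAL: bookkeeping over module 1's off-window price, p480837 ∕ p477267 BY NAME and the tree's `T4GenFunBounds` ∕ `T4CauchySum`; NOT a discharge claim.

WHAT IT SAYS.  N19's DECL target `Spine.NE7.Target vol l₀ δ Z = MatchingModConstants vol l₀ δ Z ∧ Summable δ` carries a source window `|t| ≤ l₀`; in the K3⁗
skeleton (⁗ and ⁵ alike) the windows are pinned to the record's (`KeyedWindow`).  For the scheme's dressed partition functions `Z = schemeZ S os` (mgf's of the `[−1, 1]`-valued
product observable under the Gibbs probability measures, `T4GenFunBounds.genFun_schemeZ_eq_cgf`) THE WINDOW IS NOT LOAD-BEARING: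
§1 (two probability spaces, `|X|, |Y| ≤ B`): cgf's `ε`-close on `|t| ≤ l₀` are, UNIFORMLY on `|t| ≤ l₁`,
`2·max(1, l₁B)·e^{(l₀+l₁)B}·ε^{1 − 2·arcosh(l₁∕l₀)∕arcosh(1 + log⁺ε⁻¹∕(l₀B))}`-close (module 1 at the sources it covers, the trivial `2|t|B` beyond, `ε = 0` by the
identity it forces); §3 at the scheme (§2 = the summability lemma): ★★ `matchingModConstants_enlarge` — `MatchingModConstants vol l₀ δ (schemeZ S os)` ⇒ `MatchingModConstants vol l₁ δ′ (schemeZ S os)`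
for every `l₁ ≥ l₀`, with the displayed `δ′`; ★ `summable_enlarge_of_geomRate` — if `δ` is geometric (`T4CauchySum.GeomRate C θ δ`, `θ < 1`) then `δ′` is summable
(eventually `δ′_K ≤ const·√(2volδ_K)`); ★★ `target_enlarge_of_geomRate` — `Spine.NE7.Target vol l₀ δ (schemeZ S os)` with geometric `δ` ⇒ `Target vol l₁ δ′ (schemeZ S os)`.
The qualitative every-source convergence of p501027 (`…N19TargetEverySource`) gives NO summable increments off the window; this does.

KERNEL-CHECKED (0 `def`, 0 `sorry`): §1 [folklore] `mgf_eq_of_cgf_close_zero` (ε = 0 ⇒ the mgf's agree at every real source), `abs_cgf_le_of_abs_le`,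
★ `abs_cgf_sub_cgf_le_enlarge` (the uniform bound on `|t| ≤ l₁`) · §2 [folklore] ★ `summable_enlarge_of_geomRate` (real analysis) · §3 [bookkeeping]
`abs_genFun_succ_sub_le_offWindow` (pointwise at `|t| ≥ l₀`), `abs_genFun_succ_sub_le_enlarge` (uniform on `|t| ≤ l₁`), ★★ `matchingModConstants_enlarge`,
★★ `target_enlarge_of_geomRate`, `exists_target_enlarge_of_geomRate`.

NOT CLAIMED: summability of `δ′` for a general summable `δ` (`δ^{1−o(1)}` need not be summable; geometric suffices); optimal constants.
HONEST FRAMING (binding).  Elementary; NO consumer in the DAG today; located future use: a producer that delivers N19's `Target` on a window SMALLER than the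
record's `θ.γ` reaches the record's window by `target_enlarge_of_geomRate` (geometric remainders).  Nothing of [Balaban1987RG1]–[Balaban1989LargeFieldII] or
[King1986] is asserted, quoted or instantiated; NE7 ∕ NE7b ∕ NE7c NOT PRINTED, NOT proved; N19 NOT discharged; Track A count unmoved (typed 28∕28 · discharged
5∕27 · A 5∕28).  One finite `T⁴` programme at fixed `ε`; nothing continuum ∕ `ℝ⁴` ∕ OS ∕ mass-gap ∕ Clay.  THEOREMS ONLY; standard axioms; no cite tags.
-/

set_option autoImplicit false
noncomputable section

open Set Metric Filter Topology MeasureTheory ProbabilityTheory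
open scoped BigOperators

namespace Summit.QuantumFields.YangMills.Theorems.BalabanUVNodesN19OffWindowPriceAtScheme
open Literature.MathematicalPhysics.QuantumFieldTheory.Balaban1983to89
open T4CauchySum (MatchingModConstants genFun GeomRate abs_genFun_succ_sub_le)
open T4GenFunBounds (schemeZ prodObs)
open Missing (TorusScheme)
open Summit.QuantumFields.BalabanUV.T4Continuum.Spine
open Summit.QuantumFields.YangMills.BalabanUVNodes.N19ExpectationCurrencyTwoConstants (abs_mgf_sub_mgf_le_of_cgf_close)
open Summit.QuantumFields.YangMills.BalabanUVNodes.N19ExpectationCurrencyAtScheme (mul_nonneg_of_matchingModConstants)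
open Summit.QuantumFields.YangMills.Theorems.BalabanUVNodesN19OffWindowPrice
  (abs_mgf_sub_mgf_le_offWindow_gauge abs_cgf_sub_cgf_le_offWindow)

/-! ## §1 Two probability spaces: the off-window price UNIFORMLY on an enlarged window [folklore] -/
section MGF

variable {Ω Ω' : Type*} [MeasurableSpace Ω] [MeasurableSpace Ω'] {μ : Measure Ω} {ν : Measure Ω'}
  [IsProbabilityMeasure μ] [IsProbabilityMeasure ν] {X : Ω → ℝ} {Y : Ω' → ℝ} {B : ℝ}

/-- **`ε = 0`: cgf's that agree on a window belong to mgf's that agree at EVERY real source** (module 1's gauge form at a strip height above `arcosh(|t|∕l₀)`: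
the bound `0^{1−s}·M^{s}` vanishes for `s < 1`; inside the window p480837's `abs_mgf_sub_mgf_le_of_cgf_close`). [folklore] -/
theorem mgf_eq_of_cgf_close_zero (hX : AEMeasurable X μ) (hY : AEMeasurable Y ν)
    (hXB : ∀ᵐ ω ∂μ, |X ω| ≤ B) (hYB : ∀ᵐ ω ∂ν, |Y ω| ≤ B) {l₀ : ℝ} (hl₀ : 0 < l₀)
    (hε : ∀ s : ℝ, |s| ≤ l₀ → |cgf Y ν s - cgf X μ s| ≤ 0) (t : ℝ) : mgf Y ν t = mgf X μ t := by
  rcases le_or_gt |t| l₀ with ht | ht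
  · have h := abs_mgf_sub_mgf_le_of_cgf_close hX hY hXB hYB (hε t ht)
    rw [mul_zero, zero_mul] at h
    exact eq_of_abs_sub_nonpos h
  · set v : ℝ := Real.arcosh (|t| / l₀) with hv
    have h1 : 1 ≤ |t| / l₀ := by rw [le_div_iff₀ hl₀, one_mul]; exact ht.le
    have hv0 : 0 ≤ v := Real.arcosh_nonneg h1
    have hV : 0 < v + 1 := by linarith
    have key := abs_mgf_sub_mgf_le_offWindow_gauge hX hY hXB hYB (V := v + 1) hl₀ hV hε ht.le (by rw [← hv]; linarith)
    have hs : 1 - v / (v + 1) ≠ 0 := by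
      rw [sub_ne_zero, ne_comm, ne_eq, div_eq_one_iff_eq hV.ne']
      linarith
    rw [← hv, mul_zero, zero_mul, Real.zero_rpow hs, zero_mul] at key
    exact eq_of_abs_sub_nonpos key

/-- `|cgf X μ t| ≤ |t|·B` for a probability measure and `|X| ≤ B` a.e. (`T4GenFunBounds.abs_cgf_sub_log_le_of_abs_le`, mass one). [folklore] -/
theorem abs_cgf_le_of_abs_le (hX : AEMeasurable X μ) (hXB : ∀ᵐ ω ∂μ, |X ω| ≤ B) (t : ℝ) : |cgf X μ t| ≤ |t| * B := by
  have h := T4GenFunBounds.abs_cgf_sub_log_le_of_abs_le hX hXB t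
  rwa [probReal_univ, Real.log_one, sub_zero] at h

/-- **THE OFF-WINDOW PRICE, UNIFORMLY ON AN ENLARGED WINDOW.**  Two probability spaces, `|X|, |Y| ≤ B` a.e. (`0 < B`), cgf's `ε`-close on `|s| ≤ l₀`
(`0 < l₀ ≤ l₁`, `0 ≤ ε`); then for every `|t| ≤ l₁`:
`|cgf_Y(t) − cgf_X(t)| ≤ 2·max(1, l₁B)·e^{(l₀+l₁)B}·ε^{1 − 2·arcosh(l₁∕l₀)∕arcosh(1 + log⁺ε⁻¹∕(l₀B))}`.
Cases: `ε = 0` (identity, `mgf_eq_of_cgf_close_zero`); `log⁺ε⁻¹ = 0` (then `ε ≥ 1` and the trivial `2|t|B` is below the bound); else inside the window (`ε ≤ ε^{θ}`),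
at the sources module 1 covers (`abs_cgf_sub_cgf_le_offWindow`, monotone in `arcosh(|t|∕l₀)`), and beyond them (`ε > e^{−B(|t|−l₀)}` makes the trivial bound smaller).
[folklore] -/
theorem abs_cgf_sub_cgf_le_enlarge (hX : AEMeasurable X μ) (hY : AEMeasurable Y ν)
    (hXB : ∀ᵐ ω ∂μ, |X ω| ≤ B) (hYB : ∀ᵐ ω ∂ν, |Y ω| ≤ B) {ε l₀ l₁ t : ℝ} (hl₀ : 0 < l₀) (hl₁ : l₀ ≤ l₁) (hB : 0 < B)
    (hε0 : 0 ≤ ε) (hε : ∀ s : ℝ, |s| ≤ l₀ → |cgf Y ν s - cgf X μ s| ≤ ε) (ht : |t| ≤ l₁) :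
    |cgf Y ν t - cgf X μ t| ≤
      2 * max 1 (l₁ * B) * Real.exp ((l₀ + l₁) * B) *
        ε ^ (1 - 2 * Real.arcosh (l₁ / l₀) / Real.arcosh (1 + Real.posLog ε⁻¹ / (l₀ * B))) := by
  set L : ℝ := Real.posLog ε⁻¹ with hLdef
  set V : ℝ := Real.arcosh (1 + L / (l₀ * B)) with hVdef
  set θ : ℝ := 1 - 2 * Real.arcosh (l₁ / l₀) / V with hθdef
  set A : ℝ := 2 * max 1 (l₁ * B) * Real.exp ((l₀ + l₁) * B) with hAdef
  have hl₁0 : 0 < l₁ := hl₀.trans_le hl₁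
  have hL0 : 0 ≤ L := Real.posLog_nonneg
  have hV0 : 0 ≤ V := Real.arcosh_nonneg (le_add_of_nonneg_right (div_nonneg hL0 (mul_pos hl₀ hB).le))
  have hv₁0 : 0 ≤ Real.arcosh (l₁ / l₀) := Real.arcosh_nonneg (by rw [le_div_iff₀ hl₀, one_mul]; exact hl₁)
  have hθ1 : θ ≤ 1 := by
    have : 0 ≤ 2 * Real.arcosh (l₁ / l₀) / V := div_nonneg (by positivity) hV0
    linarith
  have hexp1 : 1 ≤ Real.exp ((l₀ + l₁) * B) := Real.one_le_exp (by positivity)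
  have hA1 : 1 ≤ A := by
    have : (1 : ℝ) ≤ max 1 (l₁ * B) := le_max_left _ _
    calc (1 : ℝ) = 2⁻¹ * (2 * 1 * 1) := by norm_num
      _ ≤ 1 * (2 * max 1 (l₁ * B) * Real.exp ((l₀ + l₁) * B)) := by gcongr; norm_num
      _ = A := one_mul _
  have hA0 : 0 ≤ A := zero_le_one.trans hA1
  -- the trivial bound `2|t|B ≤ 2 l₁ B`
  have htriv : |cgf Y ν t - cgf X μ t| ≤ 2 * (l₁ * B) := by
    calc |cgf Y ν t - cgf X μ t| ≤ |cgf Y ν t| + |cgf X μ t| := abs_sub _ _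
      _ ≤ |t| * B + |t| * B := add_le_add (abs_cgf_le_of_abs_le hY hYB t) (abs_cgf_le_of_abs_le hX hXB t)
      _ ≤ l₁ * B + l₁ * B := by gcongr
      _ = 2 * (l₁ * B) := by ring
  rcases hε0.eq_or_lt with hε00 | hεpos
  · -- `ε = 0`: identity
    have heq : mgf Y ν t = mgf X μ t :=
      mgf_eq_of_cgf_close_zero hX hY hXB hYB hl₀ (fun s hs => (hε s hs).trans hε00.symm.le) t
    have : cgf Y ν t - cgf X μ t = 0 := by rw [cgf, cgf, heq, sub_self]
    rw [this, abs_zero]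
    exact mul_nonneg hA0 (Real.rpow_nonneg hε0 _)
  rcases hL0.eq_or_lt with hL00 | hLpos
  · -- `log⁺ ε⁻¹ = 0`: `ε ≥ 1`, `V = 0`, `θ = 1`
    have hε1 : 1 ≤ ε := by
      have h := (Real.posLog_eq_zero_iff _).1 hL00.symm
      rw [abs_of_nonneg (inv_nonneg.2 hε0)] at h
      exact (inv_le_one₀ hεpos).1 h
    have hV00 : V = 0 := by rw [hVdef, ← hL00, zero_div, add_zero, Real.arcosh_zero]
    have hθ : θ = 1 := by rw [hθdef, hV00, div_zero, sub_zero]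
    rw [hθ, Real.rpow_one]
    calc |cgf Y ν t - cgf X μ t| ≤ 2 * (l₁ * B) := htriv
      _ ≤ 2 * max 1 (l₁ * B) * Real.exp ((l₀ + l₁) * B) * 1 := by
          rw [mul_one]
          calc 2 * (l₁ * B) = 2 * (l₁ * B) * 1 := (mul_one _).symm
            _ ≤ 2 * max 1 (l₁ * B) * Real.exp ((l₀ + l₁) * B) := by gcongr; exact le_max_right _ _
      _ ≤ A * ε := by rw [hAdef]; gcongr
  · -- `0 < log⁺ ε⁻¹`: `0 < ε < 1`, `0 < V`, `ε ≤ ε^θ`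
    have hε1 : ε < 1 := by
      have h1 : 1 < ε⁻¹ := by
        refine lt_of_not_ge fun h => ?_
        have : Real.posLog ε⁻¹ = 0 := (Real.posLog_eq_zero_iff _).2 (by rw [abs_of_nonneg (inv_nonneg.2 hε0)]; exact h)
        exact hLpos.ne' (by rw [hLdef, this])
      exact (one_lt_inv₀ hεpos).1 h1
    have hLlog : L = Real.log ε⁻¹ := by
      rw [hLdef, Real.posLog_eq_log (by rw [abs_of_pos (inv_pos.2 hεpos)]; exact (one_lt_inv₀ hεpos).2 hε1 |>.le)]
    have hεexp : ε = Real.exp (-L) := by rw [hLlog, Real.log_inv, neg_neg, Real.exp_log hεpos]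
    have hVpos : 0 < V := Real.arcosh_pos (lt_add_of_pos_right _ (div_pos hLpos (mul_pos hl₀ hB)))
    have hεθ : ε ≤ ε ^ θ := by
      calc ε = ε ^ (1 : ℝ) := (Real.rpow_one ε).symm
        _ ≤ ε ^ θ := Real.rpow_le_rpow_of_exponent_ge hεpos hε1.le hθ1
    rcases le_or_gt |t| l₀ with htin | htout
    · -- inside the window
      calc |cgf Y ν t - cgf X μ t| ≤ ε := hε t htin
        _ ≤ 1 * ε ^ θ := by rw [one_mul]; exact hεθ
        _ ≤ A * ε ^ θ := by gcongr
    rcases le_or_gt (B * (|t| - l₀)) L with hclose | hfar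
    · -- the sources module 1 covers
      have key := abs_cgf_sub_cgf_le_offWindow hX hY hXB hYB hl₀ hB hε0 hε htout.le hclose
      have hvt : Real.arcosh (|t| / l₀) ≤ Real.arcosh (l₁ / l₀) := by
        rw [Real.arcosh_le_arcosh (div_pos (hl₀.trans htout) hl₀) (div_pos hl₁0 hl₀)]
        exact div_le_div_of_nonneg_right ht hl₀.le
      have hmono : ε ^ (1 - 2 * Real.arcosh (|t| / l₀) / V) ≤ ε ^ θ := by
        refine Real.rpow_le_rpow_of_exponent_ge hεpos hε1.le ?_
        rw [hθdef]
        have : 2 * Real.arcosh (|t| / l₀) / V ≤ 2 * Real.arcosh (l₁ / l₀) / V :=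
          div_le_div_of_nonneg_right (by linarith) hVpos.le
        linarith
      calc |cgf Y ν t - cgf X μ t|
          ≤ 2 * Real.exp ((l₀ + |t|) * B) * ε ^ (1 - 2 * Real.arcosh (|t| / l₀) / V) := key
        _ ≤ 2 * Real.exp ((l₀ + l₁) * B) * ε ^ θ := by
            gcongr
        _ = 2 * 1 * Real.exp ((l₀ + l₁) * B) * ε ^ θ := by ring
        _ ≤ A * ε ^ θ := by rw [hAdef]; gcongr; exact le_max_left _ _
    · -- beyond: `ε > e^{−B(|t|−l₀)} ≥ e^{−B(l₁−l₀)}`, so the trivial bound is below `A·ε ≤ A·ε^θ`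
      have hεlow : Real.exp (-(B * (l₁ - l₀))) ≤ ε := by
        rw [hεexp, Real.exp_le_exp]
        have : B * (|t| - l₀) ≤ B * (l₁ - l₀) := mul_le_mul_of_nonneg_left (by linarith) hB.le
        linarith
      calc |cgf Y ν t - cgf X μ t| ≤ 2 * (l₁ * B) := htriv
        _ = 2 * (l₁ * B) * Real.exp ((l₀ + l₁) * B) * Real.exp (-(B * (l₁ - l₀))) * Real.exp (-(2 * l₀ * B)) := by
            rw [mul_assoc (2 * (l₁ * B)), mul_assoc (2 * (l₁ * B)), ← Real.exp_add, ← Real.exp_add]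
            rw [show (l₀ + l₁) * B + -(B * (l₁ - l₀)) + -(2 * l₀ * B) = 0 by ring, Real.exp_zero, mul_one]
        _ ≤ 2 * (l₁ * B) * Real.exp ((l₀ + l₁) * B) * Real.exp (-(B * (l₁ - l₀))) * 1 := by
            gcongr
            exact Real.exp_le_one_iff.2 (by nlinarith)
        _ ≤ 2 * max 1 (l₁ * B) * Real.exp ((l₀ + l₁) * B) * ε * 1 := by
            gcongr
            exact le_max_right _ _
        _ = A * ε := by rw [hAdef, mul_one]
        _ ≤ A * ε ^ θ := by gcongr

end MGF

/-! ## §2 Real analysis: the enlarged remainder of a geometric `δ` is summable [folklore] -/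

section Summable

/-- **A GEOMETRIC REMAINDER STAYS SUMMABLE ON EVERY WINDOW.**  If `0 ≤ δ_K ≤ |δ_K| ≤ C·θ^K` (`T4CauchySum.GeomRate C θ δ`, `0 ≤ θ < 1`; `0 < vol`,
`0 < l₀ ≤ l₁`) then the enlarged remainder `δ′` of `matchingModConstants_enlarge` is summable: eventually `2volδ_K ≤ e^{−l₀·cosh(4·arcosh(l₁∕l₀))}`, where the
exponent is `≥ 1∕2`, so `δ′_K ≤ const·√(2volC)·(√θ)^K`. [folklore] -/
theorem summable_enlarge_of_geomRate {vol l₀ l₁ C θ : ℝ} {δ : ℕ → ℝ} (hl₀ : 0 < l₀) (hl₁ : l₀ ≤ l₁) (hvol : 0 < vol)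
    (hδ0 : ∀ K, 0 ≤ δ K) (hθ : 0 ≤ θ) (hθ1 : θ < 1) (hG : GeomRate C θ δ) :
    Summable (fun K => 2 * max 1 l₁ * Real.exp (l₀ + l₁) / vol *
      (2 * (vol * δ K)) ^ (1 - 2 * Real.arcosh (l₁ / l₀) / Real.arcosh (1 + Real.posLog (2 * (vol * δ K))⁻¹ / l₀))) := by
  set v₁ : ℝ := Real.arcosh (l₁ / l₀) with hv₁
  set A : ℝ := 2 * max 1 l₁ * Real.exp (l₀ + l₁) / vol with hA
  have hA0 : 0 ≤ A := by positivity
  have hv₁0 : 0 ≤ v₁ := Real.arcosh_nonneg (by rw [le_div_iff₀ hl₀, one_mul]; exact hl₁)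
  set εK : ℕ → ℝ := fun K => 2 * (vol * δ K) with hεK
  have hε0 : ∀ K, 0 ≤ εK K := fun K => mul_nonneg two_pos.le (mul_nonneg hvol.le (hδ0 K))
  have hC0 : 0 ≤ C := by
    have h := hG 0
    rw [pow_zero, mul_one] at h
    exact (abs_nonneg _).trans h
  have hεle : ∀ K, εK K ≤ 2 * vol * C * θ ^ K := fun K => by
    have h := hG K
    rw [abs_of_nonneg (hδ0 K)] at h
    calc εK K = 2 * vol * δ K := by rw [hεK]; ring
      _ ≤ 2 * vol * (C * θ ^ K) := by gcongr
      _ = 2 * vol * C * θ ^ K := by ring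
  -- the threshold below which the exponent is at least `1/2`
  set η : ℝ := Real.exp (-(l₀ * Real.cosh (4 * v₁))) with hη
  have hη0 : 0 < η := Real.exp_pos _
  have hη1 : η < 1 := by
    rw [hη, ← Real.exp_zero, Real.exp_lt_exp]
    have := Real.cosh_pos (4 * v₁)
    nlinarith
  -- eventually `εK K ≤ η`
  have hev : ∃ K₀ : ℕ, ∀ K, K₀ ≤ K → εK K ≤ η := by
    have ht : Tendsto (fun K : ℕ => 2 * vol * C * θ ^ K) atTop (𝓝 (2 * vol * C * 0)) :=
      (tendsto_pow_atTop_nhds_zero_of_lt_one hθ hθ1).const_mul _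
    rw [mul_zero] at ht
    obtain ⟨K₀, hK₀⟩ := (ht.eventually (ge_mem_nhds hη0)).exists_forall_of_atTop
    exact ⟨K₀, fun K hK => (hεle K).trans (hK₀ K hK)⟩
  obtain ⟨K₀, hK₀⟩ := hev
  -- for those `K`: `εK K ^ θ_K ≤ √(εK K)`
  have hexp : ∀ K, K₀ ≤ K →
      εK K ^ (1 - 2 * v₁ / Real.arcosh (1 + Real.posLog (εK K)⁻¹ / l₀)) ≤ Real.sqrt (εK K) := fun K hK => by
    have hKη := hK₀ K hK
    rcases (hε0 K).eq_or_lt with h0 | hpos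
    · -- `εK K = 0`
      rw [← h0, Real.sqrt_zero, inv_zero]
      have : Real.posLog (0 : ℝ) = 0 := (Real.posLog_eq_zero_iff _).2 (by simp)
      rw [this, zero_div, add_zero, Real.arcosh_zero, div_zero, sub_zero, Real.rpow_one]
    have hε1 : εK K < 1 := hKη.trans_lt hη1
    have hL : l₀ * Real.cosh (4 * v₁) ≤ Real.posLog (εK K)⁻¹ := by
      rw [Real.posLog_eq_log (by rw [abs_of_pos (inv_pos.2 hpos)]; exact ((one_lt_inv₀ hpos).2 hε1).le), Real.log_inv]
      have h := Real.log_le_log hpos hKη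
      rw [hη, Real.log_exp] at h
      linarith
    have hP0 : 0 ≤ Real.posLog (εK K)⁻¹ := Real.posLog_nonneg
    have hV : 4 * v₁ ≤ Real.arcosh (1 + Real.posLog (εK K)⁻¹ / l₀) := by
      calc 4 * v₁ = Real.arcosh (Real.cosh (4 * v₁)) := (Real.arcosh_cosh (by positivity)).symm
        _ ≤ Real.arcosh (1 + Real.posLog (εK K)⁻¹ / l₀) := by
            rw [Real.arcosh_le_arcosh (Real.cosh_pos _) (by positivity)]
            have : Real.cosh (4 * v₁) ≤ Real.posLog (εK K)⁻¹ / l₀ := by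
              rw [le_div_iff₀ hl₀, mul_comm]; exact hL
            linarith
    have hhalf : (1 : ℝ) / 2 ≤ 1 - 2 * v₁ / Real.arcosh (1 + Real.posLog (εK K)⁻¹ / l₀) := by
      rcases hv₁0.eq_or_lt with hv0 | hvpos
      · rw [← hv0, mul_zero, zero_div, sub_zero]; norm_num
      · have hVpos : 0 < Real.arcosh (1 + Real.posLog (εK K)⁻¹ / l₀) := by linarith
        have : 2 * v₁ / Real.arcosh (1 + Real.posLog (εK K)⁻¹ / l₀) ≤ 1 / 2 := by
          rw [div_le_iff₀ hVpos]; linarith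
        linarith
    rw [Real.sqrt_eq_rpow]
    exact Real.rpow_le_rpow_of_exponent_ge hpos hε1.le hhalf
  -- compare with the geometric majorant from `K₀` on
  have hmaj : Summable fun K => A * Real.sqrt (2 * vol * C * θ ^ (K + K₀)) := by
    have hs : Summable fun K => Real.sqrt (2 * vol * C * θ ^ K) := by
      have e : (fun K => Real.sqrt (2 * vol * C * θ ^ K)) = fun K => Real.sqrt (2 * vol * C) * (Real.sqrt θ) ^ K := by
        funext K
        rw [Real.sqrt_mul (by positivity), Real.sqrt_eq_rpow (θ ^ K), ← Real.rpow_natCast θ K, ← Real.rpow_mul hθ,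
          mul_comm (K : ℝ), Real.rpow_mul hθ, Real.rpow_natCast, ← Real.sqrt_eq_rpow]
      rw [e]
      exact (summable_geometric_of_lt_one (Real.sqrt_nonneg _)
        (by rw [Real.sqrt_lt' one_pos, one_pow]; exact hθ1) ).mul_left _
    exact ((summable_nat_add_iff K₀).2 hs).mul_left A
  refine (summable_nat_add_iff K₀).1 (Summable.of_nonneg_of_le (fun K => ?_) (fun K => ?_) hmaj)
  · exact mul_nonneg hA0 (Real.rpow_nonneg (hε0 _) _)
  · have hK : K₀ ≤ K + K₀ := Nat.le_add_left _ _
    calc A * εK (K + K₀) ^ (1 - 2 * v₁ / Real.arcosh (1 + Real.posLog (εK (K + K₀))⁻¹ / l₀))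
        ≤ A * Real.sqrt (εK (K + K₀)) := mul_le_mul_of_nonneg_left (hexp _ hK) hA0
      _ ≤ A * Real.sqrt (2 * vol * C * θ ^ (K + K₀)) :=
          mul_le_mul_of_nonneg_left (Real.sqrt_le_sqrt (hεle _)) hA0

end Summable

/-! ## §3 At the scheme: the window of `MatchingModConstants` ∕ `Spine.NE7.Target` enlarges [bookkeeping] -/

section Scheme
variable {G : Type*} [GaugeGroup G] [MeasurableSpace G] [RegularGaugeGroup G] [HaarData G] {O : Type*}
  (S : TorusScheme G O) (hβ : ∀ K, 0 ≤ S.β K) (hm : ∀ K o, Measurable (S.obs K o))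
  (h1 : ∀ K o U, |S.obs K o U| ≤ 1)
include hβ hm h1

/-- **OFF-WINDOW, POINTWISE.**  Under `MatchingModConstants vol l₀ δ (schemeZ S os)` (`0 < l₀`): at every real source `t` with `l₀ ≤ |t|` and
`|t| − l₀ ≤ log⁺(2volδ_K)⁻¹`, `|G_{K+1}(t) − G_K(t)| ≤ 2e^{l₀+|t|}·(2volδ_K)^{1 − 2·arcosh(|t|∕l₀)∕arcosh(1 + log⁺(2volδ_K)⁻¹∕l₀)}` — module 1's
`abs_cgf_sub_cgf_le_offWindow` at `B = 1` for the product observable under the two Gibbs measures (`genFun_schemeZ_eq_cgf`; window closeness `2volδ_K` by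
`T4CauchySum.abs_genFun_succ_sub_le`). [bookkeeping] -/
theorem abs_genFun_succ_sub_le_offWindow {vol l₀ : ℝ} {δ : ℕ → ℝ} (hl₀ : 0 < l₀) (os : List O)
    (hM : MatchingModConstants vol l₀ δ (schemeZ S os)) (K : ℕ) {t : ℝ} (hl : l₀ ≤ |t|)
    (hL : |t| - l₀ ≤ Real.posLog (2 * (vol * δ K))⁻¹) :
    |genFun (schemeZ S os) (K + 1) t - genFun (schemeZ S os) K t| ≤
      2 * Real.exp (l₀ + |t|) *
        (2 * (vol * δ K)) ^ (1 - 2 * Real.arcosh (|t| / l₀) / Real.arcosh (1 + Real.posLog (2 * (vol * δ K))⁻¹ / l₀)) := by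
  haveI hP : ∀ K, IsProbabilityMeasure (T4GenFunBounds.gibbsMeasure (G := G) (S.P K) (S.β K)) := fun K =>
    T4GenFunBounds.isProbabilityMeasure_gibbsMeasure (G := G) (S.P K) (hβ K)
  have hmeas : ∀ K, AEMeasurable (prodObs S K os) (T4GenFunBounds.gibbsMeasure (S.P K) (S.β K)) := fun K =>
    (T4GenFunBounds.measurable_prodObs S hm K os).aemeasurable
  have hbd : ∀ K, ∀ᵐ U ∂(T4GenFunBounds.gibbsMeasure (G := G) (S.P K) (S.β K)), |prodObs S K os U| ≤ 1 := fun K =>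
    Eventually.of_forall (T4GenFunBounds.abs_prodObs_le_one S h1 K os)
  have hε0 : 0 ≤ 2 * (vol * δ K) := mul_nonneg two_pos.le (mul_nonneg_of_matchingModConstants hl₀.le hM K)
  have hε : ∀ s : ℝ, |s| ≤ l₀ →
      |cgf (prodObs S (K + 1) os) (T4GenFunBounds.gibbsMeasure (S.P (K + 1)) (S.β (K + 1))) s -
        cgf (prodObs S K os) (T4GenFunBounds.gibbsMeasure (S.P K) (S.β K)) s| ≤ 2 * (vol * δ K) := fun s hs => by
    rw [← T4GenFunBounds.genFun_schemeZ_eq_cgf S hβ hm h1, ← T4GenFunBounds.genFun_schemeZ_eq_cgf S hβ hm h1]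
    exact abs_genFun_succ_sub_le hM hl₀.le K hs
  have key := abs_cgf_sub_cgf_le_offWindow (hmeas K) (hmeas (K + 1)) (hbd K) (hbd (K + 1)) hl₀ one_pos hε0 hε hl
    (by rwa [one_mul])
  rw [← T4GenFunBounds.genFun_schemeZ_eq_cgf S hβ hm h1, ← T4GenFunBounds.genFun_schemeZ_eq_cgf S hβ hm h1, mul_one,
    mul_one] at key
  exact key

/-- **OFF-WINDOW, UNIFORMLY ON `|t| ≤ l₁`.**  Under `MatchingModConstants vol l₀ δ (schemeZ S os)` (`0 < l₀ ≤ l₁`): for every `K` and every `|t| ≤ l₁`,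
`|G_{K+1}(t) − G_K(t)| ≤ 2·max(1, l₁)·e^{l₀+l₁}·(2volδ_K)^{1 − 2·arcosh(l₁∕l₀)∕arcosh(1 + log⁺(2volδ_K)⁻¹∕l₀)}` — §1's `abs_cgf_sub_cgf_le_enlarge` at `B = 1`.
[bookkeeping] -/
theorem abs_genFun_succ_sub_le_enlarge {vol l₀ l₁ : ℝ} {δ : ℕ → ℝ} (hl₀ : 0 < l₀) (hl₁ : l₀ ≤ l₁) (os : List O)
    (hM : MatchingModConstants vol l₀ δ (schemeZ S os)) (K : ℕ) {t : ℝ} (ht : |t| ≤ l₁) :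
    |genFun (schemeZ S os) (K + 1) t - genFun (schemeZ S os) K t| ≤
      2 * max 1 l₁ * Real.exp (l₀ + l₁) *
        (2 * (vol * δ K)) ^ (1 - 2 * Real.arcosh (l₁ / l₀) / Real.arcosh (1 + Real.posLog (2 * (vol * δ K))⁻¹ / l₀)) := by
  haveI hP : ∀ K, IsProbabilityMeasure (T4GenFunBounds.gibbsMeasure (G := G) (S.P K) (S.β K)) := fun K =>
    T4GenFunBounds.isProbabilityMeasure_gibbsMeasure (G := G) (S.P K) (hβ K)
  have hmeas : ∀ K, AEMeasurable (prodObs S K os) (T4GenFunBounds.gibbsMeasure (S.P K) (S.β K)) := fun K =>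
    (T4GenFunBounds.measurable_prodObs S hm K os).aemeasurable
  have hbd : ∀ K, ∀ᵐ U ∂(T4GenFunBounds.gibbsMeasure (G := G) (S.P K) (S.β K)), |prodObs S K os U| ≤ 1 := fun K =>
    Eventually.of_forall (T4GenFunBounds.abs_prodObs_le_one S h1 K os)
  have hε0 : 0 ≤ 2 * (vol * δ K) := mul_nonneg two_pos.le (mul_nonneg_of_matchingModConstants hl₀.le hM K)
  have hε : ∀ s : ℝ, |s| ≤ l₀ →
      |cgf (prodObs S (K + 1) os) (T4GenFunBounds.gibbsMeasure (S.P (K + 1)) (S.β (K + 1))) s -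
        cgf (prodObs S K os) (T4GenFunBounds.gibbsMeasure (S.P K) (S.β K)) s| ≤ 2 * (vol * δ K) := fun s hs => by
    rw [← T4GenFunBounds.genFun_schemeZ_eq_cgf S hβ hm h1, ← T4GenFunBounds.genFun_schemeZ_eq_cgf S hβ hm h1]
    exact abs_genFun_succ_sub_le hM hl₀.le K hs
  have key := abs_cgf_sub_cgf_le_enlarge (hmeas K) (hmeas (K + 1)) (hbd K) (hbd (K + 1)) hl₀ hl₁ one_pos hε0 hε ht
  rw [← T4GenFunBounds.genFun_schemeZ_eq_cgf S hβ hm h1, ← T4GenFunBounds.genFun_schemeZ_eq_cgf S hβ hm h1, mul_one,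
    mul_one, mul_one] at key
  exact key

/-- **THE WINDOW OF `MatchingModConstants` ENLARGES.**  `MatchingModConstants vol l₀ δ (schemeZ S os)` (`0 < l₀ ≤ l₁`, `0 < vol`) ⇒
`MatchingModConstants vol l₁ δ′ (schemeZ S os)` with `vol·δ′_K = 2·max(1, l₁)·e^{l₀+l₁}·(2volδ_K)^{1 − 2·arcosh(l₁∕l₀)∕arcosh(1 + log⁺(2volδ_K)⁻¹∕l₀)}` (the constant
`c_K = log Z_{K+1}(0) − log Z_K(0)`). [bookkeeping] -/
theorem matchingModConstants_enlarge {vol l₀ l₁ : ℝ} {δ : ℕ → ℝ} (hl₀ : 0 < l₀) (hl₁ : l₀ ≤ l₁) (hvol : 0 < vol) (os : List O)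
    (hM : MatchingModConstants vol l₀ δ (schemeZ S os)) :
    MatchingModConstants vol l₁
      (fun K => 2 * max 1 l₁ * Real.exp (l₀ + l₁) / vol *
        (2 * (vol * δ K)) ^ (1 - 2 * Real.arcosh (l₁ / l₀) / Real.arcosh (1 + Real.posLog (2 * (vol * δ K))⁻¹ / l₀)))
      (schemeZ S os) := by
  intro K
  refine ⟨Real.log (schemeZ S os (K + 1) 0) - Real.log (schemeZ S os K 0), fun t ht => ?_⟩
  have e : Real.log (schemeZ S os (K + 1) t) - Real.log (schemeZ S os K t) -
      (Real.log (schemeZ S os (K + 1) 0) - Real.log (schemeZ S os K 0)) =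
      genFun (schemeZ S os) (K + 1) t - genFun (schemeZ S os) K t := by
    unfold genFun; ring
  rw [e]
  refine (abs_genFun_succ_sub_le_enlarge S hβ hm h1 hl₀ hl₁ os hM K ht).trans (le_of_eq ?_)
  field_simp

/-- **THE WINDOW OF N19's DECL TARGET ENLARGES (geometric remainder).**  `Spine.NE7.Target vol l₀ δ (schemeZ S os)` with `δ` geometric
(`GeomRate C θ δ`, `0 ≤ θ < 1`; `0 < vol`, `0 < l₀ ≤ l₁`) ⇒ `Spine.NE7.Target vol l₁ δ′ (schemeZ S os)` with the displayed `δ′`.  `Target` is a HYPOTHESIS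
(NOT PRINTED, NOT proved). [bookkeeping] -/
theorem target_enlarge_of_geomRate {vol l₀ l₁ C θ : ℝ} {δ : ℕ → ℝ} (hl₀ : 0 < l₀) (hl₁ : l₀ ≤ l₁) (hvol : 0 < vol)
    (hθ : 0 ≤ θ) (hθ1 : θ < 1) (os : List O) (hT : NE7.Target vol l₀ δ (schemeZ S os)) (hG : GeomRate C θ δ) :
    NE7.Target vol l₁
      (fun K => 2 * max 1 l₁ * Real.exp (l₀ + l₁) / vol *
        (2 * (vol * δ K)) ^ (1 - 2 * Real.arcosh (l₁ / l₀) / Real.arcosh (1 + Real.posLog (2 * (vol * δ K))⁻¹ / l₀)))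
      (schemeZ S os) := by
  have hδ0 : ∀ K, 0 ≤ δ K := fun K =>
    (mul_nonneg_iff_of_pos_left hvol).1 (mul_nonneg_of_matchingModConstants hl₀.le hT.1 K)
  exact ⟨matchingModConstants_enlarge S hβ hm h1 hl₀ hl₁ hvol os hT.1,
    summable_enlarge_of_geomRate hl₀ hl₁ hvol hδ0 hθ hθ1 hG⟩

/-- … hence, existentially: a geometric `Target` on one window gives SOME `Target` on every larger window. [bookkeeping] -/
theorem exists_target_enlarge_of_geomRate {vol l₀ l₁ C θ : ℝ} {δ : ℕ → ℝ} (hl₀ : 0 < l₀) (hl₁ : l₀ ≤ l₁) (hvol : 0 < vol)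
    (hθ : 0 ≤ θ) (hθ1 : θ < 1) (os : List O) (hT : NE7.Target vol l₀ δ (schemeZ S os)) (hG : GeomRate C θ δ) :
    ∃ δ' : ℕ → ℝ, NE7.Target vol l₁ δ' (schemeZ S os) :=
  ⟨_, target_enlarge_of_geomRate S hβ hm h1 hl₀ hl₁ hvol hθ hθ1 os hT hG⟩

end Scheme

end Summit.QuantumFields.YangMills.Theorems.BalabanUVNodesN19OffWindowPriceAtScheme

end
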